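/-
Copyright (c) 2026. All rights reserved.
Released under Apache 2.0 license as described in the file LICENSE.
Authors: HodgeCM publication cell (pub-hodgecm), model-construction sub-cell, discharge seat `mc-discharge-2`.
-/
import Literature.NumberTheory.GelbartRogawski1991.UnitaryDualPairSeesawSchemeSmall
import Literature.NumberTheory.Weil1964.SchwartzIndicatorDeepLevelFixed
import Literature.NumberTheory.Automorphic.UnitaryGroupSymplecticFiniteAdelic
import HarnessLib

-- buildfix G11b-3 recipe (LEDGER B13-1/B13-3): elaborate sequentially so the trailing `attribute [implicit_reducible]`
-- block (reducibilityCoreExt is keyed to the async environment branch) is in force at `.olean` export.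
set_option Elab.async false

/-!
# The renormalised small pairs of scheme (small) at the splitting data of record: deep principal congruence
# levels of `U(J_V)(𝔸_{E,f})` fix the theta test functions `Φ_∞ ⊗ 𝟙_{x₀ + 𝔫𝒪̂}`

Topic `NumberTheory/GelbartRogawski1991`; namespace `Literature.NumberTheory.GelbartRogawski1991.UnitaryDualPair`.
KERNEL ONLY (0 definitions, 0 records, 0 named facts): the instantiation of
`Weil1964/SchwartzIndicatorDeepLevelFixed` §3 at the three compatible splittings `s, s₁, s₂` of
`UnitaryDualPairSeesawSchemeSmall` (data of record of [GelbartRogawski1991, §3.1 Prop. 3.1.1]), with the group-side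
hypothesis `harch` DISCHARGED by `Automorphic/UnitaryGroupSymplecticFiniteAdelic`.

* §0 (namespace `Literature.NumberTheory.Weil1964`, product set-up of `AdelicMetaplecticSeesawCharacter`: ANY splittings
  `s, s₁, s₂` over `π` on abstract groups `GV × (U₁ × U₂)`, ANY continuous `ιV : U(J)(𝔸_{E,f}) →* GV` with `harch`)
  **`exists_nat_forall_dvd_finCongruenceLevel_forall_twist_mpCharSmall₁_thinCosetTestFunₗ_eq_self`** — the renormalised
  small representation `twist (λ_V ⊠ λ₁) (ω ∘ s₁)` fixes `Φ_∞ ⊗ 𝟙_{x₀+𝔫𝒪̂}` at `(ιV k, 1)` for `k` in a deep integer level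
  (`SchwartzIndicatorDeepLevelFixed` + `continuous_mpCharV` + the units-topology glue
  `MonoidHom.continuous_of_continuous_units_val`).
* §1 `proj_pairSmall₁` / `proj_pairSmall₂`: `π(pairSmall_j s_j (g, u)) = ι_{V,W_j}(g ⊗ u)` (the `M₂`-free form of
  `proj_seesawSmall_j` of `UnitaryDualPairSeesawCharacter`), and **`proj_pairSmall₁_finAdelic_apply_archVec`**: at
  finite-adelic points `(1,k) ⊗ (1,u)`, `k ∈ U(J_V)(𝔸_{F,f})`, `u ∈ U(J₁)(𝔸_{F,f})`, the symplectic component of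
  `pairSmall₁ s₁` fixes the archimedean vectors `(archVec a, archVec w)` (idem `₂`).
* §2 **`exists_nat_forall_dvd_finCongruenceLevel_forall_twist_pairSmall₁_thinCosetTestFunₗ_eq_self`**: for continuous
  compatible `s, s₁, s₂` and every finite family of thin cosets `(x₀(a) + 𝔫(a)𝒪̂^{N M₁})_a` there is `n₀ ≠ 0` such
  that for every non-zero multiple `M` of `n₀`, every `k ∈ K_{U,f}(M𝓞_E) ≤ U(J_V)(𝔸_{E,f})`, every `a` and EVERY
  archimedean Schwartz function `Φ_∞`:
  `ω₁′((1,k), 1) (Φ_∞ ⊗ 𝟙_{x₀(a)+𝔫(a)𝒪̂}) = Φ_∞ ⊗ 𝟙_{x₀(a)+𝔫(a)𝒪̂}`,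
  where `ω₁′ := twist (charSmall₁) (ω ∘ pairSmall₁ s₁)` is EXACTLY the renormalised small representation of
  `restrictTmul₁₂` (`twist (mpCharSmall₁ (seesawBigSum s) (pairSmall₁ s₁) (pairSmall₂ s₂) (hs₃_seesaw …) …)
  ((adelicMpCont.omega …).comp (pairSmall₁ s₁))`); and **the same for the second small pair** `exists_nat_forall_dvd_finCongruenceLevel_forall_twist_pairSmall₂_thinCosetTestFunₗ_eq_self`
  (the `k = 1` line; character `λ₂(1) = 1`, so only the continuity of `s₂` enters; §0 engine `…_twist_mpCharSmall₂_…`).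

USE (pub-hodgecm model layer, E-binder `C`, fields (W-Kf′) `fixN` and (Θ-sat) `sat`; junction (J-sat)/(g5) of
`gen12`): with the PKG dictionary `testFun K J Φ x₀ N = thinCosetTestFunₗ (finEmb x₀) (N) Φ` and the line Weil action
of record `ω_{P k} = twist (charSmall_k) (ω ∘ pairSmall_k s_k)` ((S-restr) design), §2 says: the finite `K`-type
`K₂ := K_{U,f}(M)` (any non-zero multiple `M` of the level `n₀` of the finitely many cosets in play) FIXES every
`φ_N(Φ_∞)` — the family form and the all-`Φ_∞` form of `ArchKTypeData.fixN` — once `K₂` is mapped into `G_U(𝔸)` by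
`k ↦ ((1,k), 1)`. Inputs: the three `IsCompatible` witnesses (from [GelbartRogawski1991, Prop. 3.1.1], the cell's cited
hypothesis `hGR`, through `exists_pairSplitting` / `cmPairSplitting`) and the continuity of the three pair splittings.

References (provenance): S. Gelbart, J. Rogawski, Invent. Math. 105 (1991), §3.1 pp. 454–457; A. Weil, Acta Math.
111 (1964), Chap. III n° 37–41; C. Mœglin, M.-F. Vignéras, J.-L. Waldspurger, LNM 1291 (1987), Chap. 2 I.3–I.4.
-/

set_option autoImplicit false

noncomputable section

open scoped Matrix Kronecker SchwartzMap Classical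
open NumberField NumberField.mixedEmbedding IsDedekindDomain
open Literature.RepresentationTheory
open Literature.NumberTheory.Automorphic
open Literature.NumberTheory.Automorphic.UnitaryGroup
open Literature.NumberTheory.Weil1964

namespace Literature.NumberTheory.Weil1964

/-! ## §0. Scheme (small), product set-up: the renormalised small pair at finite-adelic elements of its `GV`-member -/

section SeesawSmall

variable {F : Type} [Field F] [NumberField F] {ι₁ ι₂ : Type} [Fintype ι₁] [DecidableEq ι₁] [Fintype ι₂]
  [DecidableEq ι₂] {T₁ : Matrix ι₁ ι₁ (AdeleRing (𝓞 F) F)} {T₂ : Matrix ι₂ ι₂ (AdeleRing (𝓞 F) F)}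
variable {GV U₁ U₂ : Type*} [Group GV] [Group U₁] [Group U₂] [TopologicalSpace GV] [TopologicalSpace U₁]
  [TopologicalSpace U₂]
  (s : GV × (U₁ × U₂) →* adelicMpCont F (ι₁ ⊕ ι₂) (Matrix.fromBlocks T₁ 0 0 T₂))
  (s₁ : GV × U₁ →* adelicMpCont F ι₁ T₁) (s₂ : GV × U₂ →* adelicMpCont F ι₂ T₂)
  (hs : ∀ (g : GV) (u₁ : U₁) (u₂ : U₂),
    adelicMpCont.proj F (ι₁ ⊕ ι₂) (Matrix.fromBlocks T₁ 0 0 T₂) (s (g, (u₁, u₂))) =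
      UnitaryGroup.spSum T₁ T₂
        (adelicMpCont.proj F ι₁ T₁ (s₁ (g, u₁)), adelicMpCont.proj F ι₂ T₂ (s₂ (g, u₂))))
  (hT₁ : IsUnit T₁) (hT₂ : IsUnit T₂)
variable {F₁ E : Type} [Field F₁] [Field E] [NumberField E] [Algebra F₁ E] {c : E ≃ₐ[F₁] E} {N : ℕ}
  {J : Matrix (Fin N) (Fin N) E}

/-- A homomorphism into `ℂˣ` from a topological group is continuous as soon as its values in `ℂ` are
(the inverse is `χ(k⁻¹)`). [folklore] -/
theorem _root_.MonoidHom.continuous_of_continuous_units_val {H : Type*} [Group H] [TopologicalSpace H]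
    [ContinuousInv H] (χ : H →* ℂˣ) (hχ : Continuous fun h => (χ h : ℂ)) : Continuous χ := by
  refine Units.continuous_iff.2 ⟨hχ, ?_⟩
  have h : (fun h : H => ((χ h)⁻¹ : ℂˣ) : H → ℂ) = (fun h : H => (χ h : ℂ)) ∘ fun h : H => h⁻¹ := by
    funext h
    simp only [Function.comp_apply, map_inv]
  rw [h]
  exact hχ.comp continuous_inv

/-- **Deep principal congruence levels fix `Φ_∞ ⊗ 𝟙_{x₀+𝔫𝒪̂}` under the RENORMALISED small pair of scheme (small).**
In the product see-saw set-up of `AdelicMetaplecticSeesawCharacter` (splittings `s, s₁, s₂` of `GV × (U₁ × U₂)`,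
`GV × U₁`, `GV × U₂` over `π`, continuous; `T₁, T₂` invertible), let `ιV : U(J)(𝔸_{E,f}) →* GV` be a continuous
homomorphism such that the symplectic components `π(s₁(ιV k, 1))` fix the archimedean vectors (`harch`: the
finite-adelic points act with trivial archimedean component). Then for every finite family of thin cosets there is
`n₀ ≠ 0` such that for every non-zero multiple `M` of `n₀` and every `k ∈ K_{U,f}(M𝓞_E)` the renormalised small
representation `ω₁′ = twist (λ_V ⊠ λ₁) (ω ∘ s₁)` FIXES `Φ_∞ ⊗ 𝟙_{x₀(a)+𝔫(a)𝒪̂^{ι₁}}` at `(ιV k, 1)`, for every `Φ_∞`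
(the twist character there is `λ_V(ιV k) · λ₁(1) = λ_V(ιV k)`, continuous by `continuous_mpCharV`).
[cite: GelbartRogawski1991, §3.1 p. 454, Remark p. 457; Weil1964, Chap. III n° 37–39 pp. 187–190] -/
theorem exists_nat_forall_dvd_finCongruenceLevel_forall_twist_mpCharSmall₁_thinCosetTestFunₗ_eq_self
    [IsTopologicalGroup GV] (hc : Continuous s) (hc₁ : Continuous s₁) (hc₂ : Continuous s₂)
    (ιV : UnitaryGroup.finAdelic F₁ E c N J →* GV) (hι : Continuous ιV)
    (harch : ∀ (k : UnitaryGroup.finAdelic F₁ E c N J) (a w : ι₁ → mixedSpace F),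
      (adelicMpCont.proj F ι₁ T₁ (s₁ (ιV k, 1))).1 (archVec F ι₁ a, archVec F ι₁ w) =
        (archVec F ι₁ a, archVec F ι₁ w))
    {A : Type*} [Finite A] (x₀ : A → ι₁ → FiniteAdeleRing (𝓞 F) F) (𝔫 : A → Ideal (𝓞 F)) :
    ∃ n₀ : ℕ, n₀ ≠ 0 ∧ ∀ M : ℕ, M ≠ 0 → n₀ ∣ M →
      ∀ k ∈ UnitaryGroup.finCongruenceLevel F₁ E c N J (Ideal.span {(M : 𝓞 E)}),
        ∀ a, ∀ Φ : 𝓢((ι₁ → mixedSpace F), ℂ),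
          SeesawScalar.twist (mpCharSmall₁ s s₁ s₂ hs hT₁ hT₂) ((adelicMpCont.omega F ι₁ T₁).comp s₁) (ιV k, 1)
              (thinCosetTestFunₗ (K := F) (ι := ι₁) (x₀ a) (𝔫 a) Φ) =
            thinCosetTestFunₗ (K := F) (ι := ι₁) (x₀ a) (𝔫 a) Φ := by
  -- the small splitting and the twist character read on `U(J)(𝔸_{E,f})` along `k ↦ (ιV k, 1)`
  let e : UnitaryGroup.finAdelic F₁ E c N J →* GV × U₁ := (MonoidHom.inl GV U₁).comp ιV
  have he : Continuous e := (hι.prodMk continuous_const : Continuous fun k => (ιV k, (1 : U₁)))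
  have hs' : Continuous (s₁.comp e) := hc₁.comp he
  have hχval : Continuous fun k => ((mpCharSmall₁ s s₁ s₂ hs hT₁ hT₂).comp e k : ℂ) := by
    have h : (fun k => ((mpCharSmall₁ s s₁ s₂ hs hT₁ hT₂).comp e k : ℂ)) =
        (fun g : GV => (mpCharV s s₁ s₂ hs hT₁ hT₂ g : ℂ)) ∘ ιV := by
      funext k
      simp only [Function.comp_apply, MonoidHom.comp_apply, e, MonoidHom.inl_apply, mpCharSmall₁_apply_eq_mul,
        map_one, mul_one]
    rw [h]
    exact (continuous_mpCharV s s₁ s₂ hs hT₁ hT₂ hc hc₁ hc₂).comp hι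
  have hχ : ContinuousAt ((mpCharSmall₁ s s₁ s₂ hs hT₁ hT₂).comp e) 1 :=
    (((mpCharSmall₁ s s₁ s₂ hs hT₁ hT₂).comp e).continuous_of_continuous_units_val hχval).continuousAt
  have hex := exists_nat_forall_dvd_finCongruenceLevel_forall_omega_thinCosetTestFunₗ_eq_self hT₁ (s₁.comp e) hs'
    (fun k a w => harch k a w) ((mpCharSmall₁ s s₁ s₂ hs hT₁ hT₂).comp e) hχ x₀ 𝔫
  obtain ⟨n₀, hn₀, h⟩ := hex
  refine ⟨n₀, hn₀, fun M hM hdvd k hk a Φ => ?_⟩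
  have hk' := ((h M hM hdvd k hk).2 a Φ).2
  rwa [show ((adelicMpCont.omega F ι₁ T₁).comp (s₁.comp e)) = ((adelicMpCont.omega F ι₁ T₁).comp s₁).comp e from
    rfl, twist_comp_apply] at hk'

omit [TopologicalSpace U₁] in
/-- **The second small pair.** Same set-up; the renormalised second small representation
`ω₂′ = twist λ₂ (ω ∘ s₂)` (`mpCharSmall₂ (g, u₂) = λ₂ u₂`) has TRIVIAL twist at `(ιV k, 1)` (`λ₂ 1 = 1`), so for a
continuous `s₂` and `ιV` with `harch` for `s₂ (ιV k, 1)`: for every finite family of thin cosets there is `n₀ ≠ 0` such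
that `ω₂′ (ιV k, 1)` fixes every `Φ_∞ ⊗ 𝟙_{x₀(a)+𝔫(a)𝒪̂^{ι₂}}` for `k ∈ K_{U,f}(M𝓞_E)`, `n₀ ∣ M ≠ 0`.
[cite: GelbartRogawski1991, §3.1 p. 454, Remark p. 457; Weil1964, Chap. III n° 37–39 pp. 187–190] -/
theorem exists_nat_forall_dvd_finCongruenceLevel_forall_twist_mpCharSmall₂_thinCosetTestFunₗ_eq_self
    (hc₂ : Continuous s₂) (ιV : UnitaryGroup.finAdelic F₁ E c N J →* GV) (hι : Continuous ιV)
    (harch : ∀ (k : UnitaryGroup.finAdelic F₁ E c N J) (a w : ι₂ → mixedSpace F),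
      (adelicMpCont.proj F ι₂ T₂ (s₂ (ιV k, 1))).1 (archVec F ι₂ a, archVec F ι₂ w) =
        (archVec F ι₂ a, archVec F ι₂ w))
    {A : Type*} [Finite A] (x₀ : A → ι₂ → FiniteAdeleRing (𝓞 F) F) (𝔫 : A → Ideal (𝓞 F)) :
    ∃ n₀ : ℕ, n₀ ≠ 0 ∧ ∀ M : ℕ, M ≠ 0 → n₀ ∣ M →
      ∀ k ∈ UnitaryGroup.finCongruenceLevel F₁ E c N J (Ideal.span {(M : 𝓞 E)}),
        ∀ a, ∀ Φ : 𝓢((ι₂ → mixedSpace F), ℂ),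
          SeesawScalar.twist (mpCharSmall₂ s s₁ s₂ hs hT₁ hT₂) ((adelicMpCont.omega F ι₂ T₂).comp s₂) (ιV k, 1)
              (thinCosetTestFunₗ (K := F) (ι := ι₂) (x₀ a) (𝔫 a) Φ) =
            thinCosetTestFunₗ (K := F) (ι := ι₂) (x₀ a) (𝔫 a) Φ := by
  let e : UnitaryGroup.finAdelic F₁ E c N J →* GV × U₂ := (MonoidHom.inl GV U₂).comp ιV
  have he : Continuous e := (hι.prodMk continuous_const : Continuous fun k => (ιV k, (1 : U₂)))
  have hs' : Continuous (s₂.comp e) := hc₂.comp he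
  -- the twist character read along `e` is trivial: `λ₂ 1 = 1`
  have hχ1 : (mpCharSmall₂ s s₁ s₂ hs hT₁ hT₂).comp e = 1 := by
    refine MonoidHom.ext fun k => ?_
    rw [MonoidHom.comp_apply, MonoidHom.one_apply]
    show mpCharSmall₂ s s₁ s₂ hs hT₁ hT₂ (ιV k, 1) = 1
    rw [mpCharSmall₂_apply, map_one]
  have hχ : ContinuousAt ((mpCharSmall₂ s s₁ s₂ hs hT₁ hT₂).comp e) 1 := by
    rw [hχ1]
    exact continuousAt_const
  have hex := exists_nat_forall_dvd_finCongruenceLevel_forall_omega_thinCosetTestFunₗ_eq_self hT₂ (s₂.comp e) hs'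
    (fun k a w => harch k a w) ((mpCharSmall₂ s s₁ s₂ hs hT₁ hT₂).comp e) hχ x₀ 𝔫
  obtain ⟨n₀, hn₀, h⟩ := hex
  refine ⟨n₀, hn₀, fun M hM hdvd k hk a Φ => ?_⟩
  have hk' := ((h M hM hdvd k hk).2 a Φ).2
  rwa [show ((adelicMpCont.omega F ι₂ T₂).comp (s₂.comp e)) = ((adelicMpCont.omega F ι₂ T₂).comp s₂).comp e from
    rfl, twist_comp_apply] at hk'

end SeesawSmall

end Literature.NumberTheory.Weil1964

namespace Literature.NumberTheory.GelbartRogawski1991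

namespace UnitaryDualPair

variable (F E : Type) [Field F] [NumberField F] [Field E] [NumberField E] [Algebra F E]
variable (c : E ≃ₐ[F] E) (N M₁ M₂ : ℕ) {n n₁ n₂ : ℕ}
  (eW : Fin N × Fin (M₁ + M₂) ≃ Fin n) (e₁ : Fin N × Fin M₁ ≃ Fin n₁) (e₂ : Fin N × Fin M₂ ≃ Fin n₂)
variable (JV : Matrix (Fin N) (Fin N) E) (J₁ : Matrix (Fin M₁) (Fin M₁) E) (J₂ : Matrix (Fin M₂) (Fin M₂) E)
variable {TV : Matrix (Fin N) (Fin N) F} {T₁ : Matrix (Fin M₁) (Fin M₁) F} {T₂ : Matrix (Fin M₂) (Fin M₂) F}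
variable [Algebra.IsQuadraticExtension F E] {δ : E} (hcδ : c δ = -δ) (hδ : δ ≠ 0) {d : F}
  (hd : δ * δ = algebraMap F E d) (hV : TV.IsSymm) (h₁ : T₁.IsSymm) (h₂ : T₂.IsSymm) (hVd : IsUnit TV.det)
  (h₁d : IsUnit T₁.det) (h₂d : IsUnit T₂.det) (hWd : IsUnit (finSum M₁ M₂ T₁ T₂).det)
  (hJV : JV = TV.map (algebraMap F E)) (hJ₁ : J₁ = T₁.map (algebraMap F E)) (hJ₂ : J₂ = T₂.map (algebraMap F E))
  {s : adelicPair F E c N (M₁ + M₂) JV (finSum M₁ M₂ J₁ J₂) →*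
    adelicMpCont F (Fin n) (adelicGram F eW TV (finSum M₁ M₂ T₁ T₂))}
  {s₁ : adelicPair F E c N M₁ JV J₁ →* adelicMpCont F (Fin n₁) (adelicGram F e₁ TV T₁)}
  {s₂ : adelicPair F E c N M₂ JV J₂ →* adelicMpCont F (Fin n₂) (adelicGram F e₂ TV T₂)}
  (hs : (splittingDatum F E c N (M₁ + M₂) eW JV (finSum M₁ M₂ J₁ J₂) hcδ hδ hd hV (isSymm_finSum h₁ h₂) hVd hWd hJV
    (finSum_eq_map_finSum F E M₁ M₂ J₁ J₂ hJ₁ hJ₂)).IsCompatible s)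
  (hs₁ : (splittingDatum F E c N M₁ e₁ JV J₁ hcδ hδ hd hV h₁ hVd h₁d hJV hJ₁).IsCompatible s₁)
  (hs₂ : (splittingDatum F E c N M₂ e₂ JV J₂ hcδ hδ hd hV h₂ hVd h₂d hJV hJ₂).IsCompatible s₂)

/-! ## §1. `π ∘ pairSmall_j` and its triviality on archimedean vectors at finite-adelic points -/

/-- **`π(pairSmall₁ s₁ (g, u)) = ι_{V,W₁}(g ⊗ u)`** for a compatible `s₁` (`proj_pairSplitting` read back along `e₁`).
[cite: GelbartRogawski1991, §3.1 Prop. 3.1.1 p. 455 L1–3] -/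
theorem proj_pairSmall₁
    (hs₁ : (splittingDatum F E c N M₁ e₁ JV J₁ hcδ hδ hd hV h₁ hVd h₁d hJV hJ₁).IsCompatible s₁)
    (p : adelic F E c N JV × adelic F E c M₁ J₁) :
    adelicMpCont.proj F (Fin N × Fin M₁)
        (TV.map (algebraMap F (AdeleRing (𝓞 F) F)) ⊗ₖ T₁.map (algebraMap F (AdeleRing (𝓞 F) F)))
        (pairSmall₁ F E c N M₁ e₁ JV J₁ s₁ p) =
      adelicPairToSymplectic F E c N M₁ hcδ hδ hd hV h₁ hJV hJ₁
        (dualPair (conjAdele F E c) (adelicForm E N JV) (adelicForm E M₁ J₁) p) :=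
  adelicMpCont.proj_reindex_symm_eq F e₁ _
    ((proj_pairSplitting F E c N M₁ e₁ JV J₁ hcδ hδ hd hV h₁ hVd h₁d hJV hJ₁ hs₁ p).trans
      (congrArg (fun x => toSp F E c N M₁ e₁ JV J₁ hcδ hδ hd hV h₁ hJV hJ₁ x) (adelicInl_mul_adelicInr F E c N p.1 p.2)))

/-- **`π(pairSmall₂ s₂ (g, u)) = ι_{V,W₂}(g ⊗ u)`** for a compatible `s₂`.
[cite: GelbartRogawski1991, §3.1 Prop. 3.1.1 p. 455 L1–3] -/
theorem proj_pairSmall₂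
    (hs₂ : (splittingDatum F E c N M₂ e₂ JV J₂ hcδ hδ hd hV h₂ hVd h₂d hJV hJ₂).IsCompatible s₂)
    (p : adelic F E c N JV × adelic F E c M₂ J₂) :
    adelicMpCont.proj F (Fin N × Fin M₂)
        (TV.map (algebraMap F (AdeleRing (𝓞 F) F)) ⊗ₖ T₂.map (algebraMap F (AdeleRing (𝓞 F) F)))
        (pairSmall₂ F E c N M₂ e₂ JV J₂ s₂ p) =
      adelicPairToSymplectic F E c N M₂ hcδ hδ hd hV h₂ hJV hJ₂
        (dualPair (conjAdele F E c) (adelicForm E N JV) (adelicForm E M₂ J₂) p) :=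
  adelicMpCont.proj_reindex_symm_eq F e₂ _
    ((proj_pairSplitting F E c N M₂ e₂ JV J₂ hcδ hδ hd hV h₂ hVd h₂d hJV hJ₂ hs₂ p).trans
      (congrArg (fun x => toSp F E c N M₂ e₂ JV J₂ hcδ hδ hd hV h₂ hJV hJ₂ x) (adelicInl_mul_adelicInr F E c N p.1 p.2)))

/-- **`harch` for the first small pair**: at finite-adelic points `((1,k), (1,u))` the symplectic component of
`pairSmall₁ s₁` fixes every archimedean vector `(archVec a, archVec w)` of `𝕎_𝔸 = 𝔸_F^{N M₁} × 𝔸_F^{N M₁}`.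
[cite: GelbartRogawski1991, §3.1 p. 454] -/
theorem proj_pairSmall₁_finAdelic_apply_archVec
    (hs₁ : (splittingDatum F E c N M₁ e₁ JV J₁ hcδ hδ hd hV h₁ hVd h₁d hJV hJ₁).IsCompatible s₁)
    (k : finAdelic F E c N JV) (u : finAdelic F E c M₁ J₁) (a w : Fin N × Fin M₁ → mixedSpace F) :
    (adelicMpCont.proj F (Fin N × Fin M₁)
        (TV.map (algebraMap F (AdeleRing (𝓞 F) F)) ⊗ₖ T₁.map (algebraMap F (AdeleRing (𝓞 F) F)))
        (pairSmall₁ F E c N M₁ e₁ JV J₁ s₁ (finAdelicToAdelic F E c N JV k, finAdelicToAdelic F E c M₁ J₁ u))).1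
        (archVec F (Fin N × Fin M₁) a, archVec F (Fin N × Fin M₁) w) =
      (archVec F (Fin N × Fin M₁) a, archVec F (Fin N × Fin M₁) w) := by
  rw [proj_pairSmall₁ F E c N M₁ e₁ JV J₁ hcδ hδ hd hV h₁ hVd h₁d hJV hJ₁ hs₁]
  exact adelicPairToSymplectic_dualPair_finAdelicToAdelic_apply_eq_self F E c N M₁ hcδ hδ hd hV h₁ hJV hJ₁ k u _
    (fun i => archVec_apply_snd a i) (fun i => archVec_apply_snd w i)

/-- **`harch` for the second small pair.** [cite: GelbartRogawski1991, §3.1 p. 454] -/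
theorem proj_pairSmall₂_finAdelic_apply_archVec
    (hs₂ : (splittingDatum F E c N M₂ e₂ JV J₂ hcδ hδ hd hV h₂ hVd h₂d hJV hJ₂).IsCompatible s₂)
    (k : finAdelic F E c N JV) (u : finAdelic F E c M₂ J₂) (a w : Fin N × Fin M₂ → mixedSpace F) :
    (adelicMpCont.proj F (Fin N × Fin M₂)
        (TV.map (algebraMap F (AdeleRing (𝓞 F) F)) ⊗ₖ T₂.map (algebraMap F (AdeleRing (𝓞 F) F)))
        (pairSmall₂ F E c N M₂ e₂ JV J₂ s₂ (finAdelicToAdelic F E c N JV k, finAdelicToAdelic F E c M₂ J₂ u))).1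
        (archVec F (Fin N × Fin M₂) a, archVec F (Fin N × Fin M₂) w) =
      (archVec F (Fin N × Fin M₂) a, archVec F (Fin N × Fin M₂) w) := by
  rw [proj_pairSmall₂ F E c N M₂ e₂ JV J₂ hcδ hδ hd hV h₂ hVd h₂d hJV hJ₂ hs₂]
  exact adelicPairToSymplectic_dualPair_finAdelicToAdelic_apply_eq_self F E c N M₂ hcδ hδ hd hV h₂ hJV hJ₂ k u _
    (fun i => archVec_apply_snd a i) (fun i => archVec_apply_snd w i)


/-- **`harch` for the first small pair on the `U(J_V)`-member alone**: at `((1,k), 1)` the symplectic component of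
`pairSmall₁ s₁` fixes every archimedean vector. [cite: GelbartRogawski1991, §3.1 p. 454] -/
theorem proj_pairSmall₁_finAdelic_one_apply_archVec
    (hs₁ : (splittingDatum F E c N M₁ e₁ JV J₁ hcδ hδ hd hV h₁ hVd h₁d hJV hJ₁).IsCompatible s₁)
    (k : finAdelic F E c N JV) (a w : Fin N × Fin M₁ → mixedSpace F) :
    (adelicMpCont.proj F (Fin N × Fin M₁)
        (TV.map (algebraMap F (AdeleRing (𝓞 F) F)) ⊗ₖ T₁.map (algebraMap F (AdeleRing (𝓞 F) F)))
        (pairSmall₁ F E c N M₁ e₁ JV J₁ s₁ (finAdelicToAdelic F E c N JV k, 1))).1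
        (archVec F (Fin N × Fin M₁) a, archVec F (Fin N × Fin M₁) w) =
      (archVec F (Fin N × Fin M₁) a, archVec F (Fin N × Fin M₁) w) := by
  rw [proj_pairSmall₁ F E c N M₁ e₁ JV J₁ hcδ hδ hd hV h₁ hVd h₁d hJV hJ₁ hs₁]
  exact adelicPairToSymplectic_dualPair_finAdelicToAdelic_one_apply_eq_self F E c N M₁ hcδ hδ hd hV h₁ hJV hJ₁ k _
    (fun i => archVec_apply_snd a i) (fun i => archVec_apply_snd w i)

/-- **`harch` for the second small pair on the `U(J_V)`-member alone.** [cite: GelbartRogawski1991, §3.1 p. 454] -/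
theorem proj_pairSmall₂_finAdelic_one_apply_archVec
    (hs₂ : (splittingDatum F E c N M₂ e₂ JV J₂ hcδ hδ hd hV h₂ hVd h₂d hJV hJ₂).IsCompatible s₂)
    (k : finAdelic F E c N JV) (a w : Fin N × Fin M₂ → mixedSpace F) :
    (adelicMpCont.proj F (Fin N × Fin M₂)
        (TV.map (algebraMap F (AdeleRing (𝓞 F) F)) ⊗ₖ T₂.map (algebraMap F (AdeleRing (𝓞 F) F)))
        (pairSmall₂ F E c N M₂ e₂ JV J₂ s₂ (finAdelicToAdelic F E c N JV k, 1))).1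
        (archVec F (Fin N × Fin M₂) a, archVec F (Fin N × Fin M₂) w) =
      (archVec F (Fin N × Fin M₂) a, archVec F (Fin N × Fin M₂) w) := by
  rw [proj_pairSmall₂ F E c N M₂ e₂ JV J₂ hcδ hδ hd hV h₂ hVd h₂d hJV hJ₂ hs₂]
  exact adelicPairToSymplectic_dualPair_finAdelicToAdelic_one_apply_eq_self F E c N M₂ hcδ hδ hd hV h₂ hJV hJ₂ k _
    (fun i => archVec_apply_snd a i) (fun i => archVec_apply_snd w i)

/-! ## §2. Deep levels of `U(J_V)(𝔸_{E,f})` fix `Φ_∞ ⊗ 𝟙_{x₀+𝔫𝒪̂}` under the renormalised small pairs -/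

include hs hs₁ hs₂ in
/-- **Scheme (small), first small pair, at the data of record.** For continuous compatible `s, s₁, s₂` and a finite
family of thin cosets there is `n₀ ≠ 0` such that for every non-zero multiple `M` of `n₀`, every
`k ∈ K_{U,f}(M𝓞_E) ≤ U(J_V)(𝔸_{E,f})`, every `a` and every `Φ_∞`: the renormalised small representation
`ω₁′ = twist (charSmall₁) (ω ∘ pairSmall₁ s₁)` of `restrictTmul₁₂` fixes `Φ_∞ ⊗ 𝟙_{x₀(a)+𝔫(a)𝒪̂}` at `((1,k), 1)`.
[cite: GelbartRogawski1991, §3.1 p. 454, Remark p. 457; Weil1964, Chap. III n° 37–39 pp. 187–190] -/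
theorem exists_nat_forall_dvd_finCongruenceLevel_forall_twist_pairSmall₁_thinCosetTestFunₗ_eq_self
    (hc : Continuous (pairSplitting F E c N (M₁ + M₂) eW JV (finSum M₁ M₂ J₁ J₂) s))
    (hc₁ : Continuous (pairSplitting F E c N M₁ e₁ JV J₁ s₁)) (hc₂ : Continuous (pairSplitting F E c N M₂ e₂ JV J₂ s₂))
    {A : Type*} [Finite A] (x₀ : A → Fin N × Fin M₁ → FiniteAdeleRing (𝓞 F) F) (𝔫 : A → Ideal (𝓞 F)) :
    ∃ n₀ : ℕ, n₀ ≠ 0 ∧ ∀ M : ℕ, M ≠ 0 → n₀ ∣ M →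
      ∀ k ∈ finCongruenceLevel F E c N JV (Ideal.span {(M : 𝓞 E)}), ∀ a, ∀ Φ : 𝓢((Fin N × Fin M₁ → mixedSpace F), ℂ),
        SeesawScalar.twist
            (mpCharSmall₁ (seesawBigSum F E c N M₁ M₂ eW JV J₁ J₂ s) (pairSmall₁ F E c N M₁ e₁ JV J₁ s₁)
              (pairSmall₂ F E c N M₂ e₂ JV J₂ s₂)
              (hs₃_seesaw F E c N M₁ M₂ eW e₁ e₂ JV J₁ J₂ hcδ hδ hd hV h₁ h₂ hVd h₁d h₂d hWd hJV hJ₁ hJ₂ hs hs₁ hs₂)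
              (isUnit_kronecker_map F N hVd h₁d) (isUnit_kronecker_map F N hVd h₂d))
            ((adelicMpCont.omega F (Fin N × Fin M₁)
              (TV.map (algebraMap F (AdeleRing (𝓞 F) F)) ⊗ₖ T₁.map (algebraMap F (AdeleRing (𝓞 F) F)))).comp
              (pairSmall₁ F E c N M₁ e₁ JV J₁ s₁))
            (finAdelicToAdelic F E c N JV k, 1) (thinCosetTestFunₗ (K := F) (ι := Fin N × Fin M₁) (x₀ a) (𝔫 a) Φ) =
          thinCosetTestFunₗ (K := F) (ι := Fin N × Fin M₁) (x₀ a) (𝔫 a) Φ :=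
  exists_nat_forall_dvd_finCongruenceLevel_forall_twist_mpCharSmall₁_thinCosetTestFunₗ_eq_self
    (seesawBigSum F E c N M₁ M₂ eW JV J₁ J₂ s) (pairSmall₁ F E c N M₁ e₁ JV J₁ s₁) (pairSmall₂ F E c N M₂ e₂ JV J₂ s₂)
    (hs₃_seesaw F E c N M₁ M₂ eW e₁ e₂ JV J₁ J₂ hcδ hδ hd hV h₁ h₂ hVd h₁d h₂d hWd hJV hJ₁ hJ₂ hs hs₁ hs₂)
    (isUnit_kronecker_map F N hVd h₁d) (isUnit_kronecker_map F N hVd h₂d)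
    (continuous_seesawBigSum F E c N M₁ M₂ eW JV J₁ J₂ hc) (continuous_pairSmall₁ F E c N M₁ e₁ JV J₁ hc₁)
    (continuous_pairSmall₂ F E c N M₂ e₂ JV J₂ hc₂) (finAdelicToAdelic F E c N JV) (continuous_finAdelicToAdelic F E c N JV)
    (fun k a w => proj_pairSmall₁_finAdelic_one_apply_archVec F E c N M₁ e₁ JV J₁ hcδ hδ hd hV h₁ hVd h₁d hJV hJ₁ hs₁ k a w)
    x₀ 𝔫

include hs hs₁ hs₂ in
/-- **Scheme (small), second small pair, at the data of record** (the `k = 1` line): for continuous compatible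
`s₂` (and the data `s, s₁` of the see-saw) and a finite family of thin cosets there is `n₀ ≠ 0` such that for every
non-zero multiple `M` of `n₀`, every `k ∈ K_{U,f}(M𝓞_E) ≤ U(J_V)(𝔸_{E,f})`, every `a` and every `Φ_∞`: the
renormalised second small representation `ω₂′ = twist (charSmall₂) (ω ∘ pairSmall₂ s₂)` of `restrictTmul₁₂` fixes
`Φ_∞ ⊗ 𝟙_{x₀(a)+𝔫(a)𝒪̂}` at `((1,k), 1)` (its twist `λ₂(1) = 1` is trivial there).
[cite: GelbartRogawski1991, §3.1 p. 454, Remark p. 457; Weil1964, Chap. III n° 37–39 pp. 187–190] -/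
theorem exists_nat_forall_dvd_finCongruenceLevel_forall_twist_pairSmall₂_thinCosetTestFunₗ_eq_self
    (hc₂ : Continuous (pairSplitting F E c N M₂ e₂ JV J₂ s₂))
    {A : Type*} [Finite A] (x₀ : A → Fin N × Fin M₂ → FiniteAdeleRing (𝓞 F) F) (𝔫 : A → Ideal (𝓞 F)) :
    ∃ n₀ : ℕ, n₀ ≠ 0 ∧ ∀ M : ℕ, M ≠ 0 → n₀ ∣ M →
      ∀ k ∈ finCongruenceLevel F E c N JV (Ideal.span {(M : 𝓞 E)}), ∀ a, ∀ Φ : 𝓢((Fin N × Fin M₂ → mixedSpace F), ℂ),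
        SeesawScalar.twist
            (mpCharSmall₂ (seesawBigSum F E c N M₁ M₂ eW JV J₁ J₂ s) (pairSmall₁ F E c N M₁ e₁ JV J₁ s₁)
              (pairSmall₂ F E c N M₂ e₂ JV J₂ s₂)
              (hs₃_seesaw F E c N M₁ M₂ eW e₁ e₂ JV J₁ J₂ hcδ hδ hd hV h₁ h₂ hVd h₁d h₂d hWd hJV hJ₁ hJ₂ hs hs₁ hs₂)
              (isUnit_kronecker_map F N hVd h₁d) (isUnit_kronecker_map F N hVd h₂d))
            ((adelicMpCont.omega F (Fin N × Fin M₂)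
              (TV.map (algebraMap F (AdeleRing (𝓞 F) F)) ⊗ₖ T₂.map (algebraMap F (AdeleRing (𝓞 F) F)))).comp
              (pairSmall₂ F E c N M₂ e₂ JV J₂ s₂))
            (finAdelicToAdelic F E c N JV k, 1) (thinCosetTestFunₗ (K := F) (ι := Fin N × Fin M₂) (x₀ a) (𝔫 a) Φ) =
          thinCosetTestFunₗ (K := F) (ι := Fin N × Fin M₂) (x₀ a) (𝔫 a) Φ :=
  exists_nat_forall_dvd_finCongruenceLevel_forall_twist_mpCharSmall₂_thinCosetTestFunₗ_eq_self
    (seesawBigSum F E c N M₁ M₂ eW JV J₁ J₂ s) (pairSmall₁ F E c N M₁ e₁ JV J₁ s₁) (pairSmall₂ F E c N M₂ e₂ JV J₂ s₂)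
    (hs₃_seesaw F E c N M₁ M₂ eW e₁ e₂ JV J₁ J₂ hcδ hδ hd hV h₁ h₂ hVd h₁d h₂d hWd hJV hJ₁ hJ₂ hs hs₁ hs₂)
    (isUnit_kronecker_map F N hVd h₁d) (isUnit_kronecker_map F N hVd h₂d)
    (continuous_pairSmall₂ F E c N M₂ e₂ JV J₂ hc₂) (finAdelicToAdelic F E c N JV) (continuous_finAdelicToAdelic F E c N JV)
    (fun k a w => proj_pairSmall₂_finAdelic_one_apply_archVec F E c N M₂ e₂ JV J₂ hcδ hδ hd hV h₂ hVd h₂d hJV hJ₂ hs₂ k a w)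
    x₀ 𝔫

/-! ### Build-lane note (ops-buildfix G11b-3 recipe, LEDGER B13-1, 2026-08-21)
`lean -o` (the hub build lane, never `lean`/the gate check) runs Lean 4.32's library-suggestion indexers
(`Lean.LibrarySuggestions.SymbolFrequency` / `SineQuaNon`, from their `exportEntriesFn`) over the statement of
every local theorem that is not a denied premise; on this family's statements (very large dependent binder
telescopes through the theta-kernel / dual-pair data) that fold runs for tens of minutes to hours and the build
lane kills the job (incident G11b-3, run/shared/lean/ops/buildfix/G11b-3-DOSSIER.md). `isDeniedPremise` skips
`[implicit_reducible]` constants before any fold, and a reducibility status on a *theorem* is inert (Meta never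
unfolds `thmInfo`; the kernel ignores the attribute), so the public theorems of this file are tagged
`[implicit_reducible]` purely to keep them out of that index. Only other effect: they are not offered by
`+suggestions` premise selectors. No statement or proof is changed; superseded if the operator lands a
deny-list form (`HarnessLib.PremiseIndex`). -/
set_option allowUnsafeReducibility true in
attribute [implicit_reducible]
  _root_.MonoidHom.continuous_of_continuous_units_val
  _root_.Literature.NumberTheory.Weil1964.exists_nat_forall_dvd_finCongruenceLevel_forall_twist_mpCharSmall₁_thinCosetTestFunₗ_eq_self
  _root_.Literature.NumberTheory.Weil1964.exists_nat_forall_dvd_finCongruenceLevel_forall_twist_mpCharSmall₂_thinCosetTestFunₗ_eq_self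
  proj_pairSmall₁ proj_pairSmall₂ proj_pairSmall₁_finAdelic_apply_archVec
  proj_pairSmall₂_finAdelic_apply_archVec proj_pairSmall₁_finAdelic_one_apply_archVec
  proj_pairSmall₂_finAdelic_one_apply_archVec
  exists_nat_forall_dvd_finCongruenceLevel_forall_twist_pairSmall₁_thinCosetTestFunₗ_eq_self
  exists_nat_forall_dvd_finCongruenceLevel_forall_twist_pairSmall₂_thinCosetTestFunₗ_eq_self

end UnitaryDualPair

end Literature.NumberTheory.GelbartRogawski1991

/- build-lane note, addendum (ops-buildfix B14-5, 2026-08-22): local theorem constants the `[implicit_reducible]` block above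
cannot reach — auto-realized `*.congr_simp` lemmas, structure projections / `mk.inj` / `sizeOf_spec` — are still walked by the
`.olean` exporter's premise indexers (in-file census: FOLDED = 3, proxy 6.9e+11). A global `attribute` on a realized constant lands
on an async environment branch the exporter does not consult; this file-final, top-level `local` entry goes through the
synchronous scoped extension that `getReducibilityStatusCore` reads first and is never popped before export. It is not
exported and changes no statement or proof. -/
set_option allowUnsafeReducibility true in
attribute [local implicit_reducible]
  Literature.NumberTheory.Weil1964.mpCharSmall₁.congr_simp
  Literature.NumberTheory.Weil1964.mpCharV.congr_simp
  Literature.NumberTheory.Weil1964.mpChar₁.congr_simp
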